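import Summits.QuantumFields.YangMills.Theorems.OneCertifiedCubeCrossoverCertificateDefs
import Summits.QuantumFields.YangMills.Theorems.ContinuumLimitOnTrajectory.Negative.Interleaving

/-!
# Route `OneCertifiedCube`, crux `CrossoverCertificate` (stmt-QuantumFields-16125): structure of the UV leg
# `stub_influenceConverges` of line `registered`

Support file (lead `prover-line-stmt-QuantumFields-16125-0`; found by the stub-worker of wave 1).  Two kernel-checked
structural facts about the registered signature of `stub_influenceConverges` ("along every admissible weak-coupling
scheme the TV influence `Θ_k(ℓ, n) = influence r.ρ (β_k) ⌈ℓ/a_k⌉₊ n` converges, at every `ℓ > 0`, `n ≥ 1`"),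
neither of which proves or refutes it:

* `stub_influenceConverges_of_jointLimit` — the stub FOLLOWS from the scheme-free double limit
  `∃ θ, Tendsto (fun p : ℝ × ℕ => influence r.ρ p.1 p.2 n) (atTop ×ˢ atTop) (𝓝 θ)` of the Wilson specification's
  influence (`β → ∞` and cell size `b → ∞` jointly), using of the scheme ONLY `β_k → ∞` (`HasWeakCouplingLimit`)
  and `⌈ℓ/a_k⌉₊ → ∞` (`tendsto_ceil_div_a`); `IsYangMillsFor`, `IsNontrivial`, `IsNonGaussian` are idle there.
* `influence_limits_agree_of_stub` — conversely the `∀ sch` form of the stub is a UNIVERSALITY statement: for two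
  weak-coupling schemes that are Yang–Mills for the SAME `(r, T)` the two influence sequences have the SAME limit
  (interleave the schemes — `interleave` of `Theorems/ContinuumLimitOnTrajectory/Negative/Interleaving.lean`; the
  interleaved scheme is again weak-coupling, `hasWeakCouplingLimit_interleave`, and Yang–Mills for `T`,
  `isYangMillsFor_interleave`; its influence sequence has the two given ones as even/odd subsequences).

`lsVal` is bookkeeping only (the joint lattice `n`-point function as a function of the plain step data, so that
`latticeSchwinger` of an interleaved scheme is the interleaving of the two `latticeSchwinger` sequences).

References: route file `Theses/OneCertifiedCube.lean`; `Literature/MathematicalPhysics/QuantumFieldTheory/YangMillsOS.lean`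
(`SpeciesScheme`, `latticeSchwinger`, `IsYangMillsFor`).
-/

set_option autoImplicit false

noncomputable section

namespace Summit.QuantumFields.YangMills.Cruxes.CrossoverCertificate.Birth

open MeasureTheory Filter Topology
open scoped SchwartzMap
open Literature.MathematicalPhysics.QuantumFieldTheory
open Literature.MathematicalPhysics.QuantumLattice
open Summit.QuantumFields.YangMills.Theorems.ContinuumLimitOnTrajectory.Negative

/-! ### The stub from the scheme-free joint limit -/

section Joint

variable {G : Type} [Group G] [TopologicalSpace G] [IsTopologicalGroup G] [CompactSpace G]
  [MeasurableSpace G] [BorelSpace G]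


/-- Along any scheme the cell size `⌈ℓ / a_k⌉₊` at a fixed physical length `ℓ > 0` tends to `∞`. [folklore] -/
theorem tendsto_ceil_div_a {ι : Type} (sch : SpeciesScheme ι) {ℓ : ℝ} (hℓ : 0 < ℓ) :
    Tendsto (fun k : ℕ => ⌈ℓ / sch.a k⌉₊) atTop atTop := by
  have h1 : Tendsto sch.a atTop (𝓝[>] 0) :=
    tendsto_nhdsWithin_iff.2 ⟨sch.tendsto_a, Eventually.of_forall fun k => sch.a_pos k⟩
  have h2 : Tendsto (fun k => (sch.a k)⁻¹) atTop atTop := tendsto_inv_nhdsGT_zero.comp h1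
  have h3 : Tendsto (fun k => ℓ * (sch.a k)⁻¹) atTop atTop := h2.const_mul_atTop hℓ
  refine tendsto_nat_ceil_atTop.comp ?_
  simpa [div_eq_mul_inv] using h3

/-- **The stub from the joint limit.** If for every admissible `G`, `r` and `n ≥ 1` the TV influence
`Θ(r.ρ, β, b, n)` has a limit as `(β, b) → (∞, ∞)` JOINTLY, then `stub_influenceConverges` holds (verbatim
signature as conclusion); only `β_k → ∞` and `a_k → 0⁺` of the scheme are used. [folklore] -/
theorem stub_influenceConverges_of_jointLimit
    (H : ∀ (G : Type) [Group G] [TopologicalSpace G] [IsTopologicalGroup G] [CompactSpace G]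
      [MeasurableSpace G] [BorelSpace G], IsCompactSimpleLieGroup G → ∀ (r : LatticeRep G) (n : ℕ), 1 ≤ n →
      ∃ θ : ℝ, Tendsto (fun p : ℝ × ℕ => influence r.ρ p.1 p.2 n) ((atTop : Filter ℝ) ×ˢ (atTop : Filter ℕ)) (𝓝 θ)) :
    ∀ (G : Type) [Group G] [TopologicalSpace G] [IsTopologicalGroup G] [CompactSpace G] [MeasurableSpace G]
      [BorelSpace G], IsCompactSimpleLieGroup G → ∀ (r : LatticeRep G) (sch : SpeciesScheme (YMSpecies G))
      (T : OSData (YMSpecies G) 4), sch.HasWeakCouplingLimit → IsYangMillsFor r sch T →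
      T.IsNontrivial r.curvature → T.IsNonGaussian r.curvature →
      ∀ ℓ : ℝ, 0 < ℓ → ∀ n : ℕ, 1 ≤ n →
        ∃ θ : ℝ, Tendsto (fun k : ℕ => influence r.ρ (sch.β k) ⌈ℓ / sch.a k⌉₊ n) atTop (𝓝 θ) := by
  intro G _ _ _ _ _ _ hG r sch T hW _ _ _ ℓ hℓ n hn
  obtain ⟨θ, hθ⟩ := H G hG r n hn
  have hβ : Tendsto sch.β atTop atTop := hW
  have hpair : Tendsto (fun k : ℕ => (sch.β k, ⌈ℓ / sch.a k⌉₊)) atTop ((atTop : Filter ℝ) ×ˢ (atTop : Filter ℕ)) :=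
    Filter.Tendsto.prodMk hβ (tendsto_ceil_div_a sch hℓ)
  refine ⟨θ, ?_⟩
  have h := hθ.comp hpair
  exact h

end Joint

/-! ### Interleaving: the `∀ sch` form forces scheme-independence of the limit -/

section Schemes

variable {ι : Type}

/-- Weak coupling survives interleaving. [folklore] -/
theorem hasWeakCouplingLimit_interleave {s₁ s₂ : SpeciesScheme ι} (h₁ : s₁.HasWeakCouplingLimit)
    (h₂ : s₂.HasWeakCouplingLimit) : (interleave s₁ s₂).HasWeakCouplingLimit :=
  tendsto_interleaveFun h₁ h₂

end Schemes

section YM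

variable {G : Type} [Group G] [TopologicalSpace G] [IsTopologicalGroup G] [CompactSpace G]
  [MeasurableSpace G] [BorelSpace G]

/-- The joint lattice `n`-point function as a function of the PLAIN step data `(a, β, L, c, m)`. [folklore] -/
def lsVal {N : ℕ} {ι : Type} (ρ : G →* Matrix (Fin N) (Fin N) ℂ) (obs : ι → LGConfig 4 G → ℝ) (n : ℕ)
    (σ : Fin n → ι) (f : Fin n → 𝓢(EuclideanSpace ℝ (Fin 4), ℝ)) (p : ℝ × ℝ × ℕ × (ι → ℝ) × (ι → ℝ)) : ℝ :=
  ∫ U, ∏ i, smearedLatticeField (obs (σ i)) (Literature.Probability.LatticeModels.box 4 p.2.2.1) p.1 (p.2.2.2.1 (σ i)) (p.2.2.2.2 (σ i)) (f i)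
      (torusLift (2 * p.2.2.1 + 1) U)
    ∂(wilsonMeasure (d := 4) (L := 2 * p.2.2.1 + 1) ρ p.2.1)

/-- `latticeSchwinger` is `lsVal` of the step data. [folklore] -/
theorem latticeSchwinger_eq_lsVal {N : ℕ} {ι : Type} (ρ : G →* Matrix (Fin N) (Fin N) ℂ) (sch : SpeciesScheme ι)
    (obs : ι → LGConfig 4 G → ℝ) (k n : ℕ) (σ : Fin n → ι) (f : Fin n → 𝓢(EuclideanSpace ℝ (Fin 4), ℝ)) :
    latticeSchwinger ρ sch obs k n σ f =
      lsVal ρ obs n σ f (sch.a k, sch.β k, sch.L k, fun s => sch.c s k, fun s => sch.m s k) := rfl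

/-- Step data of the interleaved scheme are the interleaved step data. [folklore] -/
theorem interleave_data {ι : Type} (s₁ s₂ : SpeciesScheme ι) (k : ℕ) :
    ((interleave s₁ s₂).a k, (interleave s₁ s₂).β k, (interleave s₁ s₂).L k,
      (fun s => (interleave s₁ s₂).c s k), (fun s => (interleave s₁ s₂).m s k)) =
      interleaveFun (fun j => (s₁.a j, s₁.β j, s₁.L j, (fun s => s₁.c s j), (fun s => s₁.m s j)))
        (fun j => (s₂.a j, s₂.β j, s₂.L j, (fun s => s₂.c s j), (fun s => s₂.m s j))) k := by
  show (interleaveFun s₁.a s₂.a k, interleaveFun s₁.β s₂.β k, interleaveFun s₁.L s₂.L k,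
      (fun s => interleaveFun (s₁.c s) (s₂.c s) k), (fun s => interleaveFun (s₁.m s) (s₂.m s) k)) = _
  unfold interleaveFun
  split_ifs <;> rfl

/-- **`IsYangMillsFor` survives interleaving (same `T`).** [folklore] -/
theorem isYangMillsFor_interleave (r : LatticeRep G) {s₁ s₂ : SpeciesScheme (YMSpecies G)}
    {T : OSData (YMSpecies G) 4} (h₁ : IsYangMillsFor r s₁ T) (h₂ : IsYangMillsFor r s₂ T) :
    IsYangMillsFor r (interleave s₁ s₂) T := by
  intro n hn σ f F hF hoff
  have key : (fun k : ℕ => ((latticeSchwinger r.ρ (interleave s₁ s₂) (fun s => s.F) k n σ f : ℝ) : ℂ)) =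
      interleaveFun (fun j => ((latticeSchwinger r.ρ s₁ (fun s => s.F) j n σ f : ℝ) : ℂ))
        (fun j => ((latticeSchwinger r.ρ s₂ (fun s => s.F) j n σ f : ℝ) : ℂ)) := by
    funext k
    simp only [latticeSchwinger_eq_lsVal]
    rw [interleave_data s₁ s₂ k,
      apply_interleaveFun (fun p => ((lsVal r.ρ (fun s : YMSpecies G => s.F) n σ f p : ℝ) : ℂ))]
  rw [key]
  exact tendsto_interleaveFun (h₁ n hn σ f F hF hoff) (h₂ n hn σ f F hF hoff)

end YM

section Universality

/-- **The universality content of the `∀ sch` quantifier.** If `stub_influenceConverges` holds (verbatim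
signature as hypothesis), then for any two weak-coupling schemes that are Yang–Mills for the SAME `(r, T)` the
two influence sequences converge to the SAME limit, at every `(ℓ, n)` (interleave the two schemes and read off the
even and odd subsequences). [folklore] -/
theorem influence_limits_agree_of_stub : (∀ (G : Type) [Group G] [TopologicalSpace G] [IsTopologicalGroup G] [CompactSpace G] [MeasurableSpace G] [BorelSpace G], IsCompactSimpleLieGroup G → ∀ (r : LatticeRep G) (sch : SpeciesScheme (YMSpecies G)) (T : OSData (YMSpecies G) 4), sch.HasWeakCouplingLimit → IsYangMillsFor r sch T → T.IsNontrivial r.curvature → T.IsNonGaussian r.curvature → ∀ ℓ : ℝ, 0 < ℓ → ∀ n : ℕ, 1 ≤ n → ∃ θ : ℝ, Tendsto (fun k : ℕ => influence r.ρ (sch.β k) ⌈ℓ / sch.a k⌉₊ n) atTop (𝓝 θ)) → ∀ (G : Type) [Group G] [TopologicalSpace G] [IsTopologicalGroup G] [CompactSpace G] [MeasurableSpace G] [BorelSpace G], IsCompactSimpleLieGroup G → ∀ (r : LatticeRep G) (s₁ s₂ : SpeciesScheme (YMSpecies G)) (T : OSData (YMSpecies G) 4), s₁.HasWeakCouplingLimit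 → s₂.HasWeakCouplingLimit → IsYangMillsFor r s₁ T → IsYangMillsFor r s₂ T → T.IsNontrivial r.curvature → T.IsNonGaussian r.curvature → ∀ ℓ : ℝ, 0 < ℓ → ∀ n : ℕ, 1 ≤ n → ∃ θ : ℝ, Tendsto (fun k : ℕ => influence r.ρ (s₁.β k) ⌈ℓ / s₁.a k⌉₊ n) atTop (𝓝 θ) ∧ Tendsto (fun k : ℕ => influence r.ρ (s₂.β k) ⌈ℓ / s₂.a k⌉₊ n) atTop (𝓝 θ) := by
  intro hStub G _ _ _ _ _ _ hG r s₁ s₂ T hW₁ hW₂ hY₁ hY₂ hNT hNG ℓ hℓ n hn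
  obtain ⟨θ, hθ⟩ := hStub G hG r (interleave s₁ s₂) T (hasWeakCouplingLimit_interleave hW₁ hW₂)
    (isYangMillsFor_interleave r hY₁ hY₂) hNT hNG ℓ hℓ n hn
  refine ⟨θ, ?_, ?_⟩
  · have h := hθ.comp tendsto_two_mul_atTop
    refine h.congr fun j => ?_
    show influence r.ρ (interleaveFun s₁.β s₂.β (2 * j)) ⌈ℓ / interleaveFun s₁.a s₂.a (2 * j)⌉₊ n = _
    rw [interleaveFun_two_mul, interleaveFun_two_mul]
  · have h := hθ.comp tendsto_two_mul_add_one_atTop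
    refine h.congr fun j => ?_
    show influence r.ρ (interleaveFun s₁.β s₂.β (2 * j + 1)) ⌈ℓ / interleaveFun s₁.a s₂.a (2 * j + 1)⌉₊ n = _
    rw [interleaveFun_two_mul_add_one, interleaveFun_two_mul_add_one]

end Universality


end Summit.QuantumFields.YangMills.Cruxes.CrossoverCertificate.Birth

end
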